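import Literature.Probability.LatticeModels.TorusFourierProofs
import Mathlib.Analysis.SpecialFunctions.Log.Basic
import HarnessLib

/-!
# Variance of a function on the torus = its Fourier tail; Chebyshev counts; smeared kernels;
# and the "few exceptional sites" bound for logarithmic means

Topic `Probability/LatticeModels`, namespace `Literature.Probability.LatticeModels`. Elementary
harmonic analysis on the discrete torus `(ℤ/Lℤ)^d` (`TorusSite d L`), in the vocabulary of
`TorusFourier.lean` / `TorusFourierProofs.lean` (unnormalised transform `torusFourier`, characters
`torusChar`, Parseval `torusFourier_plancherel_holds`):

* `torusFourier_finset_sum`, `torusFourier_const` — linearity and the transform of a constant;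
* **`card_mul_sum_sq_sub_mean_eq`** — for real `f`, `L^d · Σ_x (f x − f̄)² = Σ_{k ≠ 0} ‖f̂(k)‖²`,
  `f̄ = L^{-d} Σ f` (Parseval applied to `f − f̄`; Friedli–Velenik 2017, §10.4; Stein–Shakarchi,
  *Fourier Analysis*, Ch. 7);
* **`card_filter_le_mul_sum_sq`** — Chebyshev's count `t² · #{i : t ≤ |u i|} ≤ Σ u²` on a finite type;
* `norm_torusFourier_comp_add_right`, `norm_torusFourier_smear_le` — the transform of a translate is a
  character times the transform, so a sum of `|A|·|B|` translates has `‖·̂(k)‖ ≤ |A||B| ‖F̂(k)‖`;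
* **`sum_neg_log_div_le_of_floor`** — the counting bound for logarithmic means: if `κ ≤ h i` for all
  `i` (`κ > 0`) and `0 < θ ≤ h₀`, then `Σ_i −log(h i / h₀) ≤ N·log(h₀/θ) + #{i : h i < θ}·log(h₀/κ)`.

Together with an infrared bound `‖f̂(k)‖² E(k) ≤ B` and a lattice-sum estimate for `Σ_{k≠0} 1/E(k)`
(`TorusInverseDispersionSum2D.lean` in `d = 2`) these give the "geometric mean ≈ arithmetic mean up to
O(1)" principle for slowly varying positive kernels used by the Hubbard route `LevyLogBootstrap`
(anchor of the Lévy-mass log-bootstrap). All statements are finite sums; nothing is asymptotic.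

## References

* S. Friedli, Y. Velenik, *Statistical Mechanics of Lattice Systems* (CUP 2017), §10.4.
  [FriedliVelenik2017]
* E. M. Stein, R. Shakarchi, *Fourier Analysis: An Introduction* (Princeton 2003), Ch. 7, Thm. 1.2.
-/

noncomputable section

open Finset Complex
open scoped ComplexConjugate Real

namespace Literature.Probability.LatticeModels

variable {d L : ℕ} [NeZero L]

/-! ### Linearity, constants, and the variance identity -/

/-- `torusFourier` of a finite sum of functions is the sum of the transforms. [folklore] -/
theorem torusFourier_finset_sum {ι : Type*} (s : Finset ι) (F : ι → TorusSite d L → ℂ)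
    (k : TorusSite d L) :
    torusFourier (fun x => ∑ i ∈ s, F i x) k = ∑ i ∈ s, torusFourier (F i) k := by
  simp only [torusFourier, sum_mul]
  rw [sum_comm]

/-- The transform of a constant: `ĉ(k) = c·L^d` at `k = 0` and `0` otherwise (orthogonality of
characters, `sum_torusChar_right`). [folklore] -/
theorem torusFourier_const (c : ℂ) (k : TorusSite d L) :
    torusFourier (fun _ : TorusSite d L => c) k = if k = 0 then c * (L : ℂ) ^ d else 0 := by
  rw [torusFourier_eq_sum_torusChar, ← mul_sum, ← map_sum, sum_torusChar_right]
  split_ifs with h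
  · simp
  · simp

/-- **Variance = Fourier tail** (Parseval applied to `f − f̄`): for real `f` on `(ℤ/Lℤ)^d`,
`L^d · Σ_x (f x − f̄)² = Σ_{k ≠ 0} ‖f̂(k)‖²` with `f̄ = L^{-d} Σ_x f x`.
[cite: FriedliVelenik2017, §10.4] -/
theorem card_mul_sum_sq_sub_mean_eq (f : TorusSite d L → ℝ) :
    (L : ℝ) ^ d * ∑ x, (f x - (∑ y, f y) / (L : ℝ) ^ d) ^ 2 =
      ∑ k ∈ (univ : Finset (TorusSite d L)).erase 0, ‖torusFourier (fun x => (f x : ℂ)) k‖ ^ 2 := by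
  classical
  set fb : ℝ := (∑ y, f y) / (L : ℝ) ^ d with hfb
  have hLd : ((L : ℝ) ^ d) ≠ 0 := pow_ne_zero _ (Nat.cast_ne_zero.2 (NeZero.ne L))
  -- Parseval for `g = f - fb`
  have hP := torusFourier_plancherel_holds (d := d) (L := L) (fun x => ((f x - fb : ℝ) : ℂ))
  have hnorm : ∀ x, ‖((f x - fb : ℝ) : ℂ)‖ ^ 2 = (f x - fb) ^ 2 := fun x => by
    rw [Complex.norm_real, Real.norm_eq_abs, sq_abs]
  simp_rw [hnorm] at hP
  -- the transform of `g`
  have hg : ∀ k, torusFourier (fun x => ((f x - fb : ℝ) : ℂ)) k =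
      torusFourier (fun x => (f x : ℂ)) k - (if k = 0 then (fb : ℂ) * (L : ℂ) ^ d else 0) := by
    intro k
    have : (fun x : TorusSite d L => ((f x - fb : ℝ) : ℂ)) = fun x => (f x : ℂ) - (fb : ℂ) := by
      funext x; push_cast; ring
    have hsub : ∀ (u v : TorusSite d L → ℂ),
        torusFourier (fun x => u x - v x) k = torusFourier u k - torusFourier v k := fun u v => by
      simp only [torusFourier, sub_mul, sum_sub_distrib]
    rw [this, hsub, torusFourier_const]
  have hLc : ((L : ℂ) ^ d) ≠ 0 := natCast_pow_ne_zero
  have hfbL : (fb : ℂ) * (L : ℂ) ^ d = ∑ x, (f x : ℂ) := by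
    rw [hfb]
    push_cast
    rw [div_mul_cancel₀ _ hLc]
  have hg0 : torusFourier (fun x => ((f x - fb : ℝ) : ℂ)) 0 = 0 := by
    rw [hg, if_pos rfl, torusFourier_apply_zero, hfbL, sub_self]
  have hgk : ∀ k, k ≠ 0 → torusFourier (fun x => ((f x - fb : ℝ) : ℂ)) k =
      torusFourier (fun x => (f x : ℂ)) k := fun k hk => by rw [hg, if_neg hk, sub_zero]
  rw [← hP, ← Finset.sum_erase_add _ _ (mem_univ (0 : TorusSite d L)), hg0, norm_zero,
    zero_pow two_ne_zero, add_zero]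
  exact (sum_congr rfl fun k hk => by rw [hgk k (mem_erase.1 hk).1]).symm

/-! ### Chebyshev's count on a finite type -/

/-- **Chebyshev's inequality, counting form**: `t² · #{i : t ≤ |u i|} ≤ Σ_i (u i)²` for `t > 0`.
[folklore] -/
theorem card_filter_le_mul_sum_sq {ι : Type*} [Fintype ι] (u : ι → ℝ) {t : ℝ} (ht : 0 < t) :
    t ^ 2 * (((univ : Finset ι).filter (fun i => t ≤ |u i|)).card : ℝ) ≤ ∑ i, (u i) ^ 2 := by
  classical
  set S := (univ : Finset ι).filter (fun i => t ≤ |u i|) with hS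
  have h1 : t ^ 2 * (S.card : ℝ) = ∑ _i ∈ S, t ^ 2 := by
    rw [sum_const, nsmul_eq_mul, mul_comm]
  rw [h1]
  calc ∑ _i ∈ S, t ^ 2 ≤ ∑ i ∈ S, (u i) ^ 2 := by
        refine sum_le_sum fun i hi => ?_
        have hti : t ≤ |u i| := (mem_filter.1 hi).2
        calc t ^ 2 ≤ |u i| ^ 2 := pow_le_pow_left₀ ht.le hti 2
          _ = (u i) ^ 2 := sq_abs _
    _ ≤ ∑ i, (u i) ^ 2 :=
        sum_le_sum_of_subset_of_nonneg (filter_subset _ _) fun i _ _ => sq_nonneg _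

/-- Chebyshev count below the mean: `#{i : u i < m − t} · t² ≤ Σ_i (u i − m)²`, `t > 0`.
[folklore] -/
theorem card_filter_lt_le_sum_sq_sub {ι : Type*} [Fintype ι] (u : ι → ℝ) (m : ℝ) {t : ℝ}
    (ht : 0 < t) :
    t ^ 2 * (((univ : Finset ι).filter (fun i => u i < m - t)).card : ℝ) ≤ ∑ i, (u i - m) ^ 2 := by
  classical
  have hsub : (univ : Finset ι).filter (fun i => u i < m - t) ⊆
      (univ : Finset ι).filter (fun i => t ≤ |u i - m|) := by
    intro i hi
    rw [mem_filter] at hi ⊢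
    refine ⟨hi.1, ?_⟩
    have : u i - m ≤ -t := by linarith [hi.2]
    calc t ≤ -(u i - m) := by linarith
      _ ≤ |u i - m| := neg_le_abs _
  have hcard : (((univ : Finset ι).filter (fun i => u i < m - t)).card : ℝ) ≤
      (((univ : Finset ι).filter (fun i => t ≤ |u i - m|)).card : ℝ) := by
    exact_mod_cast card_le_card hsub
  exact (mul_le_mul_of_nonneg_left hcard (sq_nonneg t)).trans
    (card_filter_le_mul_sum_sq (fun i => u i - m) ht)

/-! ### Translates and smeared kernels -/

/-- The transform of a translate has the same norm. [folklore] -/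
theorem norm_torusFourier_comp_add_right (F : TorusSite d L → ℂ) (c k : TorusSite d L) :
    ‖torusFourier (fun x => F (x + c)) k‖ = ‖torusFourier F k‖ := by
  -- the transform of a translate is a character times the transform
  have h : torusFourier (fun x => F (x + c)) k = torusChar k c * torusFourier F k := by
    rw [torusFourier_eq_sum_torusChar, torusFourier_eq_sum_torusChar, mul_sum]
    conv_rhs => rw [← Equiv.sum_comp (Equiv.addRight c)]
    refine sum_congr rfl fun x _ => ?_
    simp only [Equiv.coe_addRight]
    rw [torusChar_add_right, map_mul]
    have h1 := torusChar_mul_conj k c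
    linear_combination (-(F (x + c) * conj (torusChar k x))) * h1
  rw [h, norm_mul, norm_torusChar, one_mul]

/-- **Smeared kernels have dominated Fourier coefficients**: for finite sets `A, B` of the torus,
`‖(Σ_{a∈A} Σ_{b∈B} F(· + a − b))̂(k)‖ ≤ |A|·|B|·‖F̂(k)‖`. [folklore] -/
theorem norm_torusFourier_smear_le (F : TorusSite d L → ℂ) (A B : Finset (TorusSite d L))
    (k : TorusSite d L) :
    ‖torusFourier (fun x => ∑ a ∈ A, ∑ b ∈ B, F (x + (a - b))) k‖ ≤
      (A.card : ℝ) * (B.card : ℝ) * ‖torusFourier F k‖ := by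
  rw [torusFourier_finset_sum]
  have hinner : ∀ a, torusFourier (fun x => ∑ b ∈ B, F (x + (a - b))) k =
      ∑ b ∈ B, torusFourier (fun x => F (x + (a - b))) k := fun a =>
    torusFourier_finset_sum B (fun b x => F (x + (a - b))) k
  simp_rw [hinner]
  calc ‖∑ a ∈ A, ∑ b ∈ B, torusFourier (fun x => F (x + (a - b))) k‖
      ≤ ∑ a ∈ A, ‖∑ b ∈ B, torusFourier (fun x => F (x + (a - b))) k‖ := norm_sum_le _ _
    _ ≤ ∑ a ∈ A, ∑ b ∈ B, ‖torusFourier (fun x => F (x + (a - b))) k‖ :=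
        sum_le_sum fun a _ => norm_sum_le _ _
    _ = ∑ _a ∈ A, ∑ _b ∈ B, ‖torusFourier F k‖ := by
        simp_rw [norm_torusFourier_comp_add_right]
    _ = (A.card : ℝ) * (B.card : ℝ) * ‖torusFourier F k‖ := by
        rw [sum_const, sum_const, nsmul_eq_mul, nsmul_eq_mul]; ring

/-! ### The counting bound for logarithmic means -/

/-- **Few exceptional sites control the logarithmic mean.** On a finite type with `N` elements, let
`h i ≥ κ > 0` for all `i` (a crude floor) and `0 < θ ≤ h₀`. Then
`Σ_i −log(h i / h₀) ≤ N · log(h₀/θ) + #{i : h i < θ} · log(h₀/κ)`: sites above the threshold `θ`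
cost at most `log(h₀/θ)` each, the exceptional ones at most `log(h₀/κ)` each. (Used with `θ` = half
the arithmetic mean and a Chebyshev count of the exceptional set.) [folklore] -/
theorem sum_neg_log_div_le_of_floor {ι : Type*} [Fintype ι] (h : ι → ℝ) {h₀ θ κ : ℝ}
    (hκ : 0 < κ) (hfloor : ∀ i, κ ≤ h i) (hθ : 0 < θ) (hθ₀ : θ ≤ h₀) :
    ∑ i, -Real.log (h i / h₀) ≤
      (Fintype.card ι : ℝ) * Real.log (h₀ / θ) +
        (((univ : Finset ι).filter (fun i => h i < θ)).card : ℝ) * Real.log (h₀ / κ) := by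
  classical
  have h₀pos : 0 < h₀ := lt_of_lt_of_le hθ hθ₀
  have hpos : ∀ i, 0 < h i := fun i => lt_of_lt_of_le hκ (hfloor i)
  -- termwise bound by the two-level majorant
  have hterm : ∀ i, -Real.log (h i / h₀) ≤
      Real.log (h₀ / θ) + (if h i < θ then Real.log (h₀ / κ) else 0) := by
    intro i
    rw [Real.log_div (hpos i).ne' h₀pos.ne', neg_sub]
    have hlogθ : 0 ≤ Real.log (h₀ / θ) := Real.log_nonneg ((one_le_div hθ).2 hθ₀)
    split_ifs with hlt
    · -- exceptional site: `log h₀ - log (h i) ≤ log h₀ - log κ = log (h₀/κ)`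
      rw [Real.log_div h₀pos.ne' hκ.ne']
      have := Real.log_le_log hκ (hfloor i)
      linarith
    · -- good site: `log h₀ - log (h i) ≤ log h₀ - log θ`
      push Not at hlt
      rw [add_zero, Real.log_div h₀pos.ne' hθ.ne']
      have := Real.log_le_log hθ hlt
      linarith
  calc ∑ i, -Real.log (h i / h₀)
      ≤ ∑ i, (Real.log (h₀ / θ) + (if h i < θ then Real.log (h₀ / κ) else 0)) :=
        sum_le_sum fun i _ => hterm i
    _ = (Fintype.card ι : ℝ) * Real.log (h₀ / θ) +
        (((univ : Finset ι).filter (fun i => h i < θ)).card : ℝ) * Real.log (h₀ / κ) := by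
        rw [sum_add_distrib, sum_const, card_univ, nsmul_eq_mul, sum_ite, sum_const_zero, add_zero,
          sum_const, nsmul_eq_mul]

/-- **Few exceptional sites control the logarithmic mean, unconditional form** (no comparison
between the threshold and `h₀` needed): with `κ ≤ h i` (`κ > 0`) and `θ > 0`,
`Σ_i −log(h i / h₀) ≤ N · log(h₀/θ) + #{i : h i < θ} · log(θ/κ)` for every `h₀ > 0`. [folklore] -/
theorem sum_neg_log_div_le_of_floor' {ι : Type*} [Fintype ι] (h : ι → ℝ) {h₀ θ κ : ℝ}
    (hκ : 0 < κ) (hfloor : ∀ i, κ ≤ h i) (hθ : 0 < θ) (h₀pos : 0 < h₀) :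
    ∑ i, -Real.log (h i / h₀) ≤
      (Fintype.card ι : ℝ) * Real.log (h₀ / θ) +
        (((univ : Finset ι).filter (fun i => h i < θ)).card : ℝ) * Real.log (θ / κ) := by
  classical
  have hpos : ∀ i, 0 < h i := fun i => lt_of_lt_of_le hκ (hfloor i)
  have hterm : ∀ i, -Real.log (h i / h₀) ≤
      Real.log (h₀ / θ) + (if h i < θ then Real.log (θ / κ) else 0) := by
    intro i
    rw [Real.log_div (hpos i).ne' h₀pos.ne', neg_sub, Real.log_div h₀pos.ne' hθ.ne']
    split_ifs with hlt
    · rw [Real.log_div hθ.ne' hκ.ne']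
      have := Real.log_le_log hκ (hfloor i)
      linarith
    · push Not at hlt
      have := Real.log_le_log hθ hlt
      linarith
  calc ∑ i, -Real.log (h i / h₀)
      ≤ ∑ i, (Real.log (h₀ / θ) + (if h i < θ then Real.log (θ / κ) else 0)) :=
        sum_le_sum fun i _ => hterm i
    _ = (Fintype.card ι : ℝ) * Real.log (h₀ / θ) +
        (((univ : Finset ι).filter (fun i => h i < θ)).card : ℝ) * Real.log (θ / κ) := by
        rw [sum_add_distrib, sum_const, card_univ, nsmul_eq_mul, sum_ite, sum_const_zero, add_zero,
          sum_const, nsmul_eq_mul]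

end Literature.Probability.LatticeModels

end
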